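import Literature.NumberTheory.PAdicHodge.BmaxPlusTRegular
import Literature.NumberTheory.PAdicHodge.BmaxPlusFrobeniusFixed
import HarnessLib

/-!
# Fontaine's lemma `(A_max)^{φ=p} ∩ ker θ ⊆ ℚ_p·t`, reduced to `t`-divisibility

Topic `Literature/NumberTheory/PAdicHodge`; namespace `Literature.NumberTheory.PAdicHodge`. THEOREMS ONLY (no definition, no named
fact, no instance). Assembly of `BmaxPlusFrobeniusFixed` (`(A_max)^{φ=1} = ℤ_p`) and `BmaxPlusTRegular` (`t` is a non-zero-divisor;
`φx = px ∧ p^k x = tq ⇒ φq = q`) on Colmez's `A_max = B_max⁺(F)`: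

* ★★ `fontaineKernel_of_tBmax_dvd` — **if every `x ∈ A_max` with `φ(x) = p·x` and `θ(x) = 0` has `p^k x ∈ t·A_max` for some `k`
  (Colmez's `t`-divisibility criterion "`t ∣ y ⇔ θ(φⁿ y) = 0` for all `n ≥ 0`", here the hypothesis `hdiv`), then every such `x`
  satisfies `p^k x = c·t` with `c ∈ ℤ_p`** — i.e. `(A_max)^{φ=p} ∩ ker θ ⊆ ℚ_p·t`, the injectivity half of the fundamental exact
  sequence `0 → ℚ_p t → (B_cris⁺)^{φ=p} → ℂ_p → 0` (Fontaine, Th. 5.3.7), modulo the one divisibility statement;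
* `frobBmaxPlus_eq_p_mul_and_theta_eq_zero_iff_of_tBmax_dvd` — the resulting characterisation
  `(φx = px ∧ θx = 0) ↔ ∃ k c, p^k x = c·t` under the same hypothesis (the converse is unconditional, `frobBmaxPlus_zpToAinf_mul_tBmax`).

Brick B7 of the φ-road of line `kato_lever` (crux K★ `stmt-BirchSwinnertonDyer-22226`, memo
`Cruxes/StarredOptimalManinUnitFiveSeven/Lines/kato-lever-K2-phi-road.md` and `…/kato-lever-K2-fontaine-lemma.md`); the remaining
research input is exactly `hdiv`. Infrastructure only: BSD / K★ are not proved by any of this.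

## References
* [FontaineAsterisque223III] J.-M. Fontaine, *Le corps des périodes p-adiques*, Astérisque 223 (1994), Exp. III Th. 5.3.7.
* [Colmez1998Annals] P. Colmez, *Théorie d'Iwasawa des représentations de de Rham d'un corps local*, Ann. of Math. 148 (1998), §III.2–III.3.
-/

noncomputable section

open WittVector Field ValuativeRel
open Literature.AlgebraicGeometry.Resolution

namespace Literature.NumberTheory.PAdicHodge

open Literature.NumberTheory.GaloisRepresentations
open Literature.NumberTheory.GaloisRepresentations.IsNonarchimedeanLocalField

variable {F : Type} [Field F] [ValuativeRel F] [TopologicalSpace F] [IsNonarchimedeanLocalField F]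
  [CharZero F] {p : ℕ} [Fact p.Prime] [Fact (¬ IsUnit (p : integerC F))]
  [IsAdicComplete (Ideal.span {(p : integerC F)}) (integerC F)]

/-- ★★ **Fontaine's lemma `(A_max)^{φ=p} ∩ ker θ ⊆ ℚ_p·t`, modulo `t`-divisibility**: if every `x ∈ A_max` with `φ(x) = p·x` and
`θ(x) = 0` has `p^k x ∈ t·A_max` for some `k`, then every such `x` satisfies `p^k x = ι(c)·t` for some `k` and some `c ∈ ℤ_p`
(`ι : ℤ_p → 𝔸_inf → A_max`): `p^k x = t q` forces `φ(q) = q` (`t` regular) and `(A_max)^{φ=1} = ℤ_p`.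
[cite: FontaineAsterisque223III, Exp. III Th. 5.3.7] [cite: Colmez1998Annals, §III.3] -/
theorem fontaineKernel_of_tBmax_dvd (hF : Function.Surjective (fontaineTheta (integerC F) p))
    (hdiv : ∀ x : BmaxPlus F p, frobBmaxPlus F p x = (p : BmaxPlus F p) * x → thetaBmaxPlus F p x = 0 →
      ∃ (k : ℕ) (q : BmaxPlus F p), (p : BmaxPlus F p) ^ k * x = tBmax * q)
    {x : BmaxPlus F p} (hx : frobBmaxPlus F p x = (p : BmaxPlus F p) * x) (hθ : thetaBmaxPlus F p x = 0) :
    ∃ (k : ℕ) (c : ℤ_[p]), (p : BmaxPlus F p) ^ k * x = ainfToBmaxPlus F p (zpToAinf c) * tBmax := by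
  obtain ⟨k, q, hq⟩ := hdiv x hx hθ
  obtain ⟨c, hc⟩ := exists_eq_ainfToBmaxPlus_zpToAinf_of_frobBmaxPlus_eq hF (frobBmaxPlus_eq_self_of_tBmax_mul_eq hF hx hq)
  exact ⟨k, c, by rw [hq, hc, mul_comm]⟩

set_option maxHeartbeats 1600000 in
/-- **Characterisation of `ℚ_p·t` inside `A_max`, modulo `t`-divisibility**: under `hdiv`, `φ(x) = p·x ∧ θ(x) = 0` iff
`p^k x = ι(c)·t` for some `k` and `c ∈ ℤ_p` (the converse uses `φt = pt`, `θ(t) = 0` and that `p^k` is regular on `A_max`).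
[cite: FontaineAsterisque223III, Exp. III Th. 5.3.7] -/
theorem frobBmaxPlus_eq_p_mul_and_theta_eq_zero_iff_of_tBmax_dvd (hF : Function.Surjective (fontaineTheta (integerC F) p))
    (hdiv : ∀ x : BmaxPlus F p, frobBmaxPlus F p x = (p : BmaxPlus F p) * x → thetaBmaxPlus F p x = 0 →
      ∃ (k : ℕ) (q : BmaxPlus F p), (p : BmaxPlus F p) ^ k * x = tBmax * q) (x : BmaxPlus F p) :
    (frobBmaxPlus F p x = (p : BmaxPlus F p) * x ∧ thetaBmaxPlus F p x = 0) ↔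
      ∃ (k : ℕ) (c : ℤ_[p]), (p : BmaxPlus F p) ^ k * x = ainfToBmaxPlus F p (zpToAinf c) * tBmax := by
  constructor
  · rintro ⟨hx, hθ⟩
    exact fontaineKernel_of_tBmax_dvd hF hdiv hx hθ
  · rintro ⟨k, c, hkc⟩
    obtain ⟨hφ, hθ⟩ := frobBmaxPlus_zpToAinf_mul_tBmax (F := F) (p := p) c
    refine ⟨?_, ?_⟩
    · -- `p^k (φx − p x) = φ(p^k x) − p (p^k x) = 0`
      refine sub_eq_zero.1 (eq_zero_of_natCast_pow_mul_eq_zero (F := F) (p := p) hF k ?_)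
      have e1 : frobBmaxPlus F p ((p : BmaxPlus F p) ^ k * x) = (p : BmaxPlus F p) ^ k * frobBmaxPlus F p x := by
        rw [map_mul, map_pow, map_natCast]
      have H : (p : BmaxPlus F p) ^ k * frobBmaxPlus F p x = (p : BmaxPlus F p) * (ainfToBmaxPlus F p (zpToAinf c) * tBmax) :=
        e1.symm.trans ((congrArg (frobBmaxPlus F p) hkc).trans hφ)
      linear_combination H - (p : BmaxPlus F p) * hkc
    · -- `p^k θ(x) = θ(p^k x) = 0` in the domain `𝒪_{ℂ_F}`
      have e3 := congrArg (thetaBmaxPlus F p) hkc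
      rw [map_mul, map_pow, map_natCast, hθ] at e3
      exact (mul_eq_zero.1 e3).resolve_left (pow_ne_zero _ (natCast_integerC_ne_zero (F := F) (Fact.out : p.Prime).ne_zero))

end Literature.NumberTheory.PAdicHodge

end
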